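import Summits.QuantumFields.BalabanUV.T4Continuum.Support.ScaleProfile
import Summits.QuantumFields.BalabanUV.T4Continuum.Support.DirichletMonotoneCutoffBounds

/-!
# `BalabanUV.T4Continuum.Support.DirichletDipCutoff` — NE2 (node U1a) formalisation swarm, sub-row `T4-U1a.S-NE2-D1-DIRICHLET°`, supplier item
# «Δ1-SKELETON» (file 3): THE GENERIC Ω-AWARE DIRECTIONAL CUTOFF `ψ_μ = Π_β (1 − dip_β)` OF AN ARBITRARY UNION OF UNIT BLOCKS — definitions,
# ranges, and the two EXACT boundary values (`ψ_μ = 0` at the `−μ`-exposed sites, `ψ_μ = 1` at the `+μ`-exposed sites)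
# (unit b2b-balaban-t4-ne2-formalise-leaf-08, gen 7, file 3)

HONEST FRAMING.  Rung (B)+1 bookkeeping at MODEL level, finite torus; pure lattice combinatorics; NE2 (U1a) is NOT proved by this file;
spine PROVED 0/9 unchanged; NOT infinite volume, NOT the mass gap, NOT Clay.  HONEST DEPENDENCY (verbatim): «continuum YM on T⁴ ⇐ BetaPertH ∧
nine spine estimates (0/9 proved); BetaPertH ⇐ (D1) ∧ (D4) ∧ CAP+tail; G-an2-4 gates asym, D1 and NE2/3/4.»

THE CONSTRUCTION (scale `R`, `4R ≤ n`; block set `S`, axis `μ`).  For every block `β` that is `−μ`-EXPOSED (`β ∈ S`, `β − e_μ ∉ S`) a DIP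
`dip_β(x) = hV_β(x) · Π_{κ ≠ μ} W_{β,κ}(x) · conn_β(x) ∈ [0,1]` is planted on its bottom face: `hV_β` = the plateau-and-ramp profile
`qprof R R` of the distance of the `μ`-coordinate of `x` to the bottom layer of `β` (from above inside the layer of `β`, from below inside the
layer under it); `W_{β,κ}` = `1` on the `κ`-range of `β` and the profile of the distance outside it (so the dip spreads over `2R` sites
into EVERY neighbouring column, face-adjacent or diagonal); `conn_β` = `1` in the layer of `β`, and in the layer below only on blocks whose
upper neighbour is in `S` (the dip is felt below the plane only through `S`).  Then **`psiS x = Π_β (1 − dip_β x)`**.  THIS FILE proves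
`0 ≤ · ≤ 1` for every piece, the plateau ∕ vanishing tables of `hV` and `W`, and the two boundary values **`psiS_eq_zero`** (at `x ∈ Ω` with
`x − e_μ ∉ Ω`: the dip of the block of `x` equals `1` there) and **`psiS_eq_one`** (at `x ∈ Ω` with `x + e_μ ∉ Ω`: NO dip is felt there — the
top layer of a block is `≥ n − 1 ≥ 2R − 1` sites above its own bottom plane, and below the next plane the connection indicator reads
`S(block + e_μ) = false`).  These are EXACT, for every `S`, every `d`, every torus (all `M_κ ≥ 1`); the intrinsic smoothness of `psiS` away
from the mixed codimension-3 cells is the next file.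

ABSOLUTE RULE (cell, verbatim): «No internally-minted statement may enter as a cited fact. Every hypothesis is either kernel-proved in
this package or a verbatim quotation of a PUBLISHED theorem with page reference. The manuscript(s) under audit are NOT citable for
their own disputed steps — they are the thing under adjudication; programme-internal (2001/route/tribunal) claims are never citable.»
[folklore] lattice bookkeeping; data definitions only; no `def … : Prop` fact (the `−μ`-exposedness `BotExp` is a decidable [shape]
predicate on data).  NOT CLAIMED: smoothness (file 4), anything at the residue; NE2; NE3.
-/

noncomputable section

open scoped BigOperators
open Finset

namespace Summit.QuantumFields.BalabanUV.T4Continuum.DirichletDipCutoff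

open Literature.MathematicalPhysics.QuantumFieldTheory.Balaban1983to89.B5Prop11Plancherel (Tor fine unitVec)
open Literature.MathematicalPhysics.QuantumFieldTheory.Balaban1983to89.B5Blocks16 (blockOf)
open Summit.QuantumFields.BalabanUV.Beta.GAN24.DirichletBoxTrace (blockReg)
open Summit.QuantumFields.BalabanUV.T4Continuum.DirichletMonotoneCutoff (offsF offsF_eq_zero_of_exit offsF_eq_last_of_exit)
open Summit.QuantumFields.BalabanUV.T4Continuum.ScaleProfile (qprof qprof_mem qprof_eq_one qprof_eq_zero prod_mem)

variable {d : ℕ} (n : ℕ) [NeZero n] (M : Fin d → ℕ) [hM : ∀ μ, NeZero (M μ)] (S : Tor M → Prop) [DecidablePred S] (μ : Fin d) (R : ℕ)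

/-! ## §1 The pieces of a dip -/

/-- [shape] the block `β` is `−μ`-EXPOSED: `β ∈ S`, `β − e_μ ∉ S` (its bottom `μ`-face is a boundary face of the block region). [folklore] -/
def BotExp (β : Tor M) : Prop := S β ∧ ¬ S (β - unitVec M μ)

/-- `BotExp` is decidable. [folklore] -/
instance (β : Tor M) : Decidable (BotExp M S μ β) := by unfold BotExp; infer_instance

/-- the HEIGHT factor of the dip of `β`: the profile `qprof R R` of the distance of the `μ`-coordinate of `x` to the bottom layer of `β`
(inside the layer of `β`: the offset; inside the layer below: `n −` offset); `0` in every other layer. [folklore] -/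
def hV (β : Tor M) (x : Tor (fine n M)) : ℝ :=
  if blockOf n M x μ = β μ then qprof R R (offsF n M x μ : ℕ)
  else if blockOf n M x μ = β μ - 1 then qprof R R (n - (offsF n M x μ : ℕ)) else 0

/-- the TRANSVERSAL WINDOW of `β` along `κ`: `1` on the `κ`-range of `β`, the profile of the distance outside it on the two neighbouring
ranges (a sum of two indicator terms, so that the torus directions with `M_κ ≤ 2` need no special treatment), `0` beyond. [folklore] -/
def Wax (β : Tor M) (κ : Fin d) (x : Tor (fine n M)) : ℝ :=
  if blockOf n M x κ = β κ then 1
  else (if blockOf n M x κ = β κ + 1 then qprof R R (offsF n M x κ : ℕ) else 0)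
     + (if blockOf n M x κ = β κ - 1 then qprof R R (n - 1 - (offsF n M x κ : ℕ)) else 0)

/-- the product of the transversal windows. [folklore] -/
def Ptr (β : Tor M) (x : Tor (fine n M)) : ℝ := ∏ κ ∈ univ.erase μ, Wax n M R β κ x

/-- the CONNECTION indicator: `1` in the layer of `β`; in the layer below, `1` exactly on the blocks whose upper neighbour is in `S`;
`0` elsewhere. [folklore] -/
def conn (β : Tor M) (x : Tor (fine n M)) : ℝ :=
  if blockOf n M x μ = β μ then 1
  else if blockOf n M x μ = β μ - 1 then (if S (blockOf n M x + unitVec M μ) then 1 else 0) else 0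

/-- the SMOOTH PART of the dip: exposedness indicator × height factor × transversal windows. [folklore] -/
def Gs (β : Tor M) (x : Tor (fine n M)) : ℝ := (if BotExp M S μ β then 1 else 0) * hV n M μ R β x * Ptr n M μ R β x

/-- **the dip of `β`**. [folklore] -/
def dip (β : Tor M) (x : Tor (fine n M)) : ℝ := Gs n M S μ R β x * conn n M S μ β x

/-- **THE CUTOFF `ψ_μ = Π_β (1 − dip_β)`**. [folklore] -/
def psiS (x : Tor (fine n M)) : ℝ := ∏ β : Tor M, (1 - dip n M S μ R β x)

/-! ## §2 Ranges -/

section Ranges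

variable {n M S μ R} (hR : 2 ≤ R) (hn : 4 * R ≤ n)
include hR

/-- `0 ≤ hV ≤ 1`. [folklore] -/
theorem hV_mem (β : Tor M) (x : Tor (fine n M)) : 0 ≤ hV n M μ R β x ∧ hV n M μ R β x ≤ 1 := by
  unfold hV; split_ifs
  · exact qprof_mem hR R _
  · exact qprof_mem hR R _
  · exact ⟨le_rfl, zero_le_one⟩

omit [NeZero n] in
include hn in
/-- the two profile terms of a window have DISJOINT supports (`4R ≤ n`): for `t < n`, `qprof R R t = 0 ∨ qprof R R (n − 1 − t) = 0`. [folklore] -/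
theorem qprof_disjoint {t : ℕ} (ht : t < n) : qprof R R t = 0 ∨ qprof R R (n - 1 - t) = 0 := by
  by_cases h : R + R ≤ t + 1
  · exact Or.inl (qprof_eq_zero hR R h)
  · exact Or.inr (qprof_eq_zero hR R (by omega))

include hn in
/-- `0 ≤ W ≤ 1`. [folklore] -/
theorem Wax_mem (β : Tor M) (κ : Fin d) (x : Tor (fine n M)) : 0 ≤ Wax n M R β κ x ∧ Wax n M R β κ x ≤ 1 := by
  have h1 := qprof_mem hR R (offsF n M x κ : ℕ)
  have h2 := qprof_mem hR R (n - 1 - (offsF n M x κ : ℕ))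
  have hdis := qprof_disjoint hR hn (offsF n M x κ).isLt
  unfold Wax
  split_ifs with h0 ha hb hb'
  · exact ⟨zero_le_one, le_rfl⟩
  · rcases hdis with h | h <;> rw [h] <;> constructor <;> linarith [h1.1, h1.2, h2.1, h2.2]
  · constructor <;> linarith [h1.1, h1.2]
  · constructor <;> linarith [h2.1, h2.2]
  · norm_num

include hn in
/-- `0 ≤ Ptr ≤ 1`. [folklore] -/
theorem Ptr_mem (β : Tor M) (x : Tor (fine n M)) : 0 ≤ Ptr n M μ R β x ∧ Ptr n M μ R β x ≤ 1 :=
  ScaleProfile.prod_mem _ fun κ _ => Wax_mem hR hn β κ x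

omit hR in
/-- `0 ≤ conn ≤ 1`. [folklore] -/
theorem conn_mem (β : Tor M) (x : Tor (fine n M)) : 0 ≤ conn n M S μ β x ∧ conn n M S μ β x ≤ 1 := by
  unfold conn; split_ifs <;> norm_num

include hn in
/-- `0 ≤ Gs ≤ 1`. [folklore] -/
theorem Gs_mem (β : Tor M) (x : Tor (fine n M)) : 0 ≤ Gs n M S μ R β x ∧ Gs n M S μ R β x ≤ 1 := by
  have hv := hV_mem hR (n := n) (M := M) (μ := μ) β x
  have hp := Ptr_mem hR hn (μ := μ) β x
  unfold Gs
  split_ifs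
  · rw [one_mul]; exact ⟨mul_nonneg hv.1 hp.1, mul_le_one₀ hv.2 hp.1 hp.2⟩
  · simp

include hn in
/-- `0 ≤ dip ≤ 1`. [folklore] -/
theorem dip_mem (β : Tor M) (x : Tor (fine n M)) : 0 ≤ dip n M S μ R β x ∧ dip n M S μ R β x ≤ 1 := by
  have hg := Gs_mem hR hn (S := S) (μ := μ) β x
  have hc := conn_mem (n := n) (S := S) (μ := μ) β x
  unfold dip
  exact ⟨mul_nonneg hg.1 hc.1, mul_le_one₀ hg.2 hc.1 hc.2⟩

include hn in
/-- `0 ≤ 1 − dip ≤ 1`. [folklore] -/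
theorem one_sub_dip_mem (β : Tor M) (x : Tor (fine n M)) : 0 ≤ 1 - dip n M S μ R β x ∧ 1 - dip n M S μ R β x ≤ 1 := by
  have h := dip_mem hR hn (S := S) (μ := μ) β x; constructor <;> linarith [h.1, h.2]

include hn in
/-- **`0 ≤ ψ_μ ≤ 1`**. [folklore] -/
theorem psiS_mem (x : Tor (fine n M)) : 0 ≤ psiS n M S μ R x ∧ psiS n M S μ R x ≤ 1 :=
  ScaleProfile.prod_mem _ fun β _ => one_sub_dip_mem hR hn β x

end Ranges

/-! ## §3 Tables of the height factor and of the windows -/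

section Tables

variable {n M S μ R} (hR : 2 ≤ R) (hn : 4 * R ≤ n)

/-- `hV = 0` two or more layers away from the bottom plane of `β`. [folklore] -/
theorem hV_eq_zero_of_far {β : Tor M} {x : Tor (fine n M)} (h1 : blockOf n M x μ ≠ β μ) (h2 : blockOf n M x μ ≠ β μ - 1) :
    hV n M μ R β x = 0 := by
  unfold hV; rw [if_neg h1, if_neg h2]

include hR hn in
/-- `hV = 0` on the top two layers of the layer of `β` (`n − 2 ≥ 2R − 1`). [folklore] -/
theorem hV_eq_zero_of_top {β : Tor M} {x : Tor (fine n M)} (h1 : blockOf n M x μ = β μ) (hr : n ≤ (offsF n M x μ : ℕ) + 2) :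
    hV n M μ R β x = 0 := by
  unfold hV; rw [if_pos h1]; exact qprof_eq_zero hR R (by omega)

include hR hn in
/-- `hV = 0` on the bottom two layers of the layer below `β`. [folklore] -/
theorem hV_eq_zero_of_bot {β : Tor M} {x : Tor (fine n M)} (h1 : blockOf n M x μ ≠ β μ) (h2 : blockOf n M x μ = β μ - 1)
    (hr : (offsF n M x μ : ℕ) ≤ 1) : hV n M μ R β x = 0 := by
  unfold hV; rw [if_neg h1, if_pos h2]; exact qprof_eq_zero hR R (by omega)

include hR in
/-- `hV = 1` on the plateau above the plane. [folklore] -/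
theorem hV_eq_one_of_up {β : Tor M} {x : Tor (fine n M)} (h1 : blockOf n M x μ = β μ) (hr : (offsF n M x μ : ℕ) ≤ R) :
    hV n M μ R β x = 1 := by
  unfold hV; rw [if_pos h1]; exact qprof_eq_one R (by omega) hr

include hR in
/-- `hV = 1` on the plateau below the plane. [folklore] -/
theorem hV_eq_one_of_dn {β : Tor M} {x : Tor (fine n M)} (h1 : blockOf n M x μ ≠ β μ) (h2 : blockOf n M x μ = β μ - 1)
    (hr : n ≤ (offsF n M x μ : ℕ) + R) : hV n M μ R β x = 1 := by
  unfold hV; rw [if_neg h1, if_pos h2]; exact qprof_eq_one R (by omega) (by omega)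

/-- the window is `1` on the own range. [folklore] -/
theorem Wax_eq_one_of_own {β : Tor M} {κ : Fin d} {x : Tor (fine n M)} (h : blockOf n M x κ = β κ) : Wax n M R β κ x = 1 := by
  unfold Wax; rw [if_pos h]

/-- the window vanishes off the own range and the two neighbouring ranges. [folklore] -/
theorem Wax_eq_zero_of_far {β : Tor M} {κ : Fin d} {x : Tor (fine n M)} (h0 : blockOf n M x κ ≠ β κ) (h1 : blockOf n M x κ ≠ β κ + 1)
    (h2 : blockOf n M x κ ≠ β κ - 1) : Wax n M R β κ x = 0 := by
  unfold Wax; rw [if_neg h0, if_neg h1, if_neg h2, add_zero]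

/-- the window on the NEXT range: the profile of the offset (when the next range is not also the previous one). [folklore] -/
theorem Wax_eq_of_next {β : Tor M} {κ : Fin d} {x : Tor (fine n M)} (h0 : blockOf n M x κ ≠ β κ) (h1 : blockOf n M x κ = β κ + 1)
    (h2 : blockOf n M x κ ≠ β κ - 1) : Wax n M R β κ x = qprof R R (offsF n M x κ : ℕ) := by
  unfold Wax; rw [if_neg h0, if_pos h1, if_neg h2, add_zero]

/-- the window on the PREVIOUS range. [folklore] -/
theorem Wax_eq_of_prev {β : Tor M} {κ : Fin d} {x : Tor (fine n M)} (h0 : blockOf n M x κ ≠ β κ) (h1 : blockOf n M x κ ≠ β κ + 1)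
    (h2 : blockOf n M x κ = β κ - 1) : Wax n M R β κ x = qprof R R (n - 1 - (offsF n M x κ : ℕ)) := by
  unfold Wax; rw [if_neg h0, if_neg h1, if_pos h2, zero_add]

/-- the window when the next range IS the previous one (`M_κ = 2`): the sum of both profiles. [folklore] -/
theorem Wax_eq_of_both {β : Tor M} {κ : Fin d} {x : Tor (fine n M)} (h0 : blockOf n M x κ ≠ β κ) (h1 : blockOf n M x κ = β κ + 1)
    (h2 : blockOf n M x κ = β κ - 1) :
    Wax n M R β κ x = qprof R R (offsF n M x κ : ℕ) + qprof R R (n - 1 - (offsF n M x κ : ℕ)) := by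
  unfold Wax; rw [if_neg h0, if_pos h1, if_pos h2]

/-- `Ptr = 1` on the own column. [folklore] -/
theorem Ptr_eq_one_of_own {β : Tor M} {x : Tor (fine n M)} (h : ∀ κ, κ ≠ μ → blockOf n M x κ = β κ) : Ptr n M μ R β x = 1 :=
  Finset.prod_eq_one fun κ hκ => Wax_eq_one_of_own (Finset.ne_of_mem_erase hκ |> fun h' => h κ h')

/-- `Ptr = 0` as soon as one window vanishes. [folklore] -/
theorem Ptr_eq_zero_of {β : Tor M} {x : Tor (fine n M)} {κ : Fin d} (hκ : κ ≠ μ) (h : Wax n M R β κ x = 0) : Ptr n M μ R β x = 0 :=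
  Finset.prod_eq_zero (Finset.mem_erase.mpr ⟨hκ, Finset.mem_univ κ⟩) h

/-- `conn = 1` in the layer of `β`. [folklore] -/
theorem conn_eq_one_of_up {β : Tor M} {x : Tor (fine n M)} (h : blockOf n M x μ = β μ) : conn n M S μ β x = 1 := by
  unfold conn; rw [if_pos h]

/-- `conn` in the layer below reads the membership of the upper neighbour. [folklore] -/
theorem conn_eq_of_dn {β : Tor M} {x : Tor (fine n M)} (h1 : blockOf n M x μ ≠ β μ) (h2 : blockOf n M x μ = β μ - 1) :
    conn n M S μ β x = if S (blockOf n M x + unitVec M μ) then 1 else 0 := by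
  unfold conn; rw [if_neg h1, if_pos h2]

/-- `conn = 0` in every other layer. [folklore] -/
theorem conn_eq_zero_of_far {β : Tor M} {x : Tor (fine n M)} (h1 : blockOf n M x μ ≠ β μ) (h2 : blockOf n M x μ ≠ β μ - 1) :
    conn n M S μ β x = 0 := by
  unfold conn; rw [if_neg h1, if_neg h2]

/-- `Gs = 0` unless `β` is `−μ`-exposed. [folklore] -/
theorem Gs_eq_zero_of_not_botExp {β : Tor M} (h : ¬ BotExp M S μ β) (x : Tor (fine n M)) : Gs n M S μ R β x = 0 := by
  unfold Gs; rw [if_neg h]; ring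

/-- `Gs` for an exposed block. [folklore] -/
theorem Gs_eq_of_botExp {β : Tor M} (h : BotExp M S μ β) (x : Tor (fine n M)) : Gs n M S μ R β x = hV n M μ R β x * Ptr n M μ R β x := by
  unfold Gs; rw [if_pos h, one_mul]

/-- `dip = 0` where the height factor vanishes. [folklore] -/
theorem dip_eq_zero_of_hV {β : Tor M} {x : Tor (fine n M)} (h : hV n M μ R β x = 0) : dip n M S μ R β x = 0 := by
  unfold dip Gs; rw [h]; ring

/-- `dip = 0` where the connection indicator vanishes. [folklore] -/
theorem dip_eq_zero_of_conn {β : Tor M} {x : Tor (fine n M)} (h : conn n M S μ β x = 0) : dip n M S μ R β x = 0 := by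
  unfold dip; rw [h, mul_zero]

/-- `dip = 0` unless `β` is `−μ`-exposed. [folklore] -/
theorem dip_eq_zero_of_not_botExp {β : Tor M} (h : ¬ BotExp M S μ β) (x : Tor (fine n M)) : dip n M S μ R β x = 0 := by
  unfold dip; rw [Gs_eq_zero_of_not_botExp h, zero_mul]

end Tables

/-! ## §4 The two boundary values of `ψ_μ` -/

section Boundary

variable {n M S μ R} (hR : 2 ≤ R) (hn : 4 * R ≤ n)
include hR hn

omit hn in
/-- **`ψ_μ = 0` AT THE `−μ`-EXPOSED SITES** (`x ∈ Ω`, `x − e_μ ∉ Ω`): the dip of the block of `x` is `1` there. [folklore] -/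
theorem psiS_eq_zero {x : Tor (fine n M)} (hx : blockReg n M S x) (hx' : ¬ blockReg n M S (x - unitVec (fine n M) μ)) :
    psiS n M S μ R x = 0 := by
  obtain ⟨h0, hS⟩ := offsF_eq_zero_of_exit n M S μ hx hx'
  have hβS : S (blockOf n M x) := hx
  have hBE : BotExp M S μ (blockOf n M x) := ⟨hβS, hS⟩
  have hV1 : hV n M μ R (blockOf n M x) x = 1 := hV_eq_one_of_up hR rfl (by rw [h0]; exact Nat.zero_le _)
  have hP1 : Ptr n M μ R (blockOf n M x) x = 1 := Ptr_eq_one_of_own fun κ _ => rfl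
  have hc1 : conn n M S μ (blockOf n M x) x = 1 := conn_eq_one_of_up rfl
  have hd : dip n M S μ R (blockOf n M x) x = 1 := by
    unfold dip; rw [Gs_eq_of_botExp hBE, hV1, hP1, hc1]; ring
  unfold psiS
  exact Finset.prod_eq_zero (Finset.mem_univ (blockOf n M x)) (by rw [hd, sub_self])

/-- **`ψ_μ = 1` AT THE `+μ`-EXPOSED SITES** (`x ∈ Ω`, `x + e_μ ∉ Ω`): no dip is felt there. [folklore] -/
theorem psiS_eq_one {x : Tor (fine n M)} (hx : blockReg n M S x) (hx' : ¬ blockReg n M S (x + unitVec (fine n M) μ)) :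
    psiS n M S μ R x = 1 := by
  obtain ⟨hlast, hS⟩ := offsF_eq_last_of_exit n M S μ hx hx'
  unfold psiS
  refine Finset.prod_eq_one fun β _ => ?_
  suffices h : dip n M S μ R β x = 0 by rw [h, sub_zero]
  by_cases h1 : blockOf n M x μ = β μ
  · exact dip_eq_zero_of_hV (hV_eq_zero_of_top hR hn h1 (by omega))
  · by_cases h2 : blockOf n M x μ = β μ - 1
    · apply dip_eq_zero_of_conn
      rw [conn_eq_of_dn h1 h2, if_neg hS]
    · exact dip_eq_zero_of_hV (hV_eq_zero_of_far h1 h2)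

end Boundary

end Summit.QuantumFields.BalabanUV.T4Continuum.DirichletDipCutoff

end
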